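/-
Copyright (c) 2026 the pub-hodgecm-mathlib formalisation cell (harness21).  Prover seat hodgecm-mathlib-LH7-p06 (g0) (re-dealt to strike line L3 `stub_N6nsDyadic` by director
s1969 (a); heir LEAD F0P3a-plan (g21) T20-16 (d)), «(D-RAM) FOUR-FRAME» road of crux H413, line LH4, (β-BAL) Stage B, β-BOARD v1 (sub-dealer LH4-p05 (g8)) ROW R2 «G₃ PURE»:
the TOKEN-FREE SHELL FILE asked for by the (P2a) holder LH4-p11 (g9) (bus 2026-09-04T15:14:39Z).  2026-09-04.
-/
import Summits.HodgeConjecture.HodgeConjecture.Theorems.F0P3cDyRamDiagonalGluedStratumG3   -- ★ p861251 (this seat): `stratum_G3_eq` (the G₃ normal form), `det_latt_G3_ne_zero`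
import Summits.HodgeConjecture.HodgeConjecture.Theorems.F0P3cDyRamLevelTokenHNF             -- ★ p859056 (LH4-p09 (g8)): `latticeInLevel_diagonal_latt_hnf_pow_iff` (the level token on an HNF lattice)
import Summits.HodgeConjecture.HodgeConjecture.Theorems.F0P3cDyRamStageOneBDefs            -- ★ DEFS №5 (F0P3a-p01 (g36)): `mcOfRecord`; brings ★ `mstarOfRecord`
import HarnessLib

/-!
# Crux `H413`, line LH4 «(D-RAM) FOUR-FRAME» — (β-BAL) Stage B, β-BOARD v1 ROW R2 «G₃ PURE», THE TOKEN-FREE SHELL READ: on the stratum `G₃ = (2ρ+s, 2ρ+s, 2ρ)`, in the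
# one-slot cell `2ρ + m* ≤ n₁`, the three clean-shell tokens of `X = diag(α−1, β−1, 0)` hold iff `2ρ + s + ℓ₀ = n₃`

Cell `hodgecm-mathlib` (D-0151), FLOOR 0, crux item H413 = `stmt-HodgeConjecture-24833`, route `HCCMUnconditional`; squad F0∕P3c∕LH4.  THEOREMS ONLY (no `def`, no instance, no
notation, no `sorry`, default heartbeats); ★-only imports; lane `--supports stmt-HodgeConjecture-24833 --as helper` (count-neutral); pays NO row, states NO law.  Twin of ★ FILE 2b
§2 `F0P3cDyRamLabelledOddPureStrataG1.shell_iff_of_mem_stratum_G1` (LH4-p11 (g8)) with the read moved to `n₃` and the cell to `n₁` (LH4-p11 (g8) `VERDICT-G3row.v1` b6c59e93 §1∕§2);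
consumers: LH4-p11 (g9)'s (P2a) per-lattice read `labelledOddCount_div_relIndex_of_mem_stratum_G3` and the (P2b) sum file `F0P3cDyRamLabelledOddPureStrataG3`.

THE MATHEMATICS.  A member of the stratum is a G₃ normal form `M = latt (1 0 0; x ϖ^{ρ+s} 0; y z ϖ^{2ρ})`, `|x| = |y| = 1`, `|z| = |ϖ|^ρ` (★ `stratum_G3_eq`).  ★ p859056 at
`(b, c) = (ρ+s, 2ρ)` reads a diagonal level token on it (§1 `latticeInLevel_diagonal_latt_G3_iff`):
`diag(e)·M ⊆ ϖ^ℓ·M ↔ (∀ i, |e_i| ≤ |ϖ|^ℓ) ∧ |e₁ − e₀| ≤ |ϖ|^{ℓ+ρ+s} ∧ |e₂ − e₁| ≤ |ϖ|^{ℓ+ρ} ∧ |(e₂ − e₀)·y·ϖ^{ρ+s} + (e₀ − e₁)·x·z| ≤ |ϖ|^{ℓ+3ρ+s}`;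
the two terms of the MIXED inequality have valuations `|e₂ − e₀|·|ϖ|^{ρ+s}` and `|e₀ − e₁|·|ϖ|^ρ`, so OFF THE CANCELLATION LOCUS `|e₂ − e₀|·|ϖ|^s ≠ |e₀ − e₁|` it splits into
`|e₂ − e₀| ≤ |ϖ|^{ℓ+2ρ} ∧ |e₀ − e₁| ≤ |ϖ|^{ℓ+2ρ+s}` and the token is CONSTANT on the stratum (§1 `latticeInLevel_diagonal_latt_G3_iff_of_ne`).  For the operators of record
`e = (α−1, β−1, 0)` of an element datum (`|β−1| = |ϖ|^{n₁}`, `|α−1| = |ϖ|^{n₂}`, `|α−β| = |ϖ|^{n₃}`, isosceles) the locus is `n₃ = n₂ + s`; there the isosceles rule forces `n₁ = n₂`,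
so in the cell `2ρ + m* ≤ n₁` every member already lies in level `ℓ₀ + 1` (no member is on the exact-`ℓ₀` shell) and the read `2ρ + s + ℓ₀ = n₃` is false; off the locus the two
level tokens read `ℓ + ρ ≤ n₁ ∧ ℓ + 2ρ ≤ n₂ ∧ ℓ + 2ρ + s ≤ n₃`, the cell and the isosceles rule (`n₂ < n₁ ⇒ n₃ = n₂`) kill the `n₁`- and `n₂`-equalities, and the square token
`diag((α−1)², (β−1)², 0)·M ⊆ ϖ^{mc}·M` is automatic (`(α−1)² − (β−1)² = (α−β)(α+β−2)`, depths `≥ N₀ ≥ mc`).  Hence (§2 HEAD **`shell_iff_of_mem_stratum_G3`**) the three shell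
tokens hold iff `2ρ + s + ℓ₀ = n₃` — for EVERY member, with NO use of `T`-stability (the statement is over any `T`), and (§2 `tube_of_read_G3`, no membership needed) on that read
`2ρ + s ≤ n₃ ∧ 2ρ ≤ n₁ ∧ 2ρ ≤ n₂`; §2 `tube_of_mem_stratum_G3` packages `2 ∣ s ∧ 2ρ ≤ n₁ ∧ 2ρ ≤ n₂` per member = the `htube` binder of ★ p861290 (LH4-p10 (g6)) (cell + isosceles; the indicator `2ρ ≤ min n₁ n₂` of the predicted column is thus automatic in the cell, as `2ρ ≤ min n₂ n₃` is on G₁).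
HONEST LABEL.  Count-neutral (`--supports`); nothing printed is asserted; row R2, the table identity (SIG-B2b3), (β-BAL), (β), T₊ remain OPEN; `HC_CM` is proved only modulo the 7
printed citations (2 remaining named inputs: hLiu418 = `stmt-HodgeConjecture-24832`, h413 = `stmt-HodgeConjecture-24833`) until rung 0 closes.

## References
* [Kottwitz1986BaseChangeUnits] R. E. Kottwitz, *Base change for unit elements of Hecke algebras*, Compositio Math. 60 (1986), §1 pp. 240–241 (fixed-lattice counting by position).
* [Rogawski1990] J. D. Rogawski, *Automorphic Representations of Unitary Groups in Three Variables*, Ann. of Math. Stud. 123 (1990), §4.9 Prop. 4.9.1 (a) p. 55 (root depths of a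
  regular elliptic element; the isosceles rule).
* [Serre1980Trees] J.-P. Serre, *Trees*, Springer (1980), Ch. II §1.1 (lattices, Hermite normal forms, levels).
-/

set_option autoImplicit false

noncomputable section

namespace Summit.HodgeConjecture.HodgeConjecture.Cruxes.H413.F0P3cDyRamLabelledOddPureStrataG3Shell

open Literature.NumberTheory.Automorphic Literature.NumberTheory.Automorphic.HermitianLattice
open Literature.NumberTheory.Automorphic.UnitaryLatticeTree Literature.NumberTheory.Automorphic.UnitaryThreeFourFrame
open Summit.HodgeConjecture.HodgeConjecture.Cruxes.H413.F0P3cDyRamFourFramePieces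
open Summit.HodgeConjecture.HodgeConjecture.Cruxes.H413.F0P3cDyRamFourFrameCensusDefs
open Summit.HodgeConjecture.HodgeConjecture.Cruxes.H413.F0P3cDyRamStageOneBDefs (mcOfRecord)
open Summit.HodgeConjecture.HodgeConjecture.Cruxes.H413.F0P3cDyRamDiagonalTorusDefs
open Summit.HodgeConjecture.HodgeConjecture.Cruxes.H413.F0P3cDyRamDiagonalStrataDefs
open Summit.HodgeConjecture.HodgeConjecture.Cruxes.H413.F0P3cDyRamDiagonalGluedStratumG3
open Summit.HodgeConjecture.HodgeConjecture.Cruxes.H413.F0P3cDyRamLevelTokenHNF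
open scoped Valued WithZero Matrix MatrixGroups

/-! ## §1  The diagonal level token on the G₃ normal form, and its constancy off the cancellation locus -/

section Read

variable {K : Type*} [Field K] [Valued K ℤᵐ⁰]

/-- **THE DIAGONAL LEVEL TOKEN ON THE G₃ NORMAL FORM** `latt (1 0 0; x ϖ^{ρ+s} 0; y z ϖ^{2ρ})` (`|x| = 1`, `|z| = |ϖ^ρ|`; `y` arbitrary here):
`diag(e)·M ⊆ ϖ^ℓ·M ↔ (∀ i, |e_i| ≤ |ϖ|^ℓ) ∧ |e₁ − e₀| ≤ |ϖ|^{ℓ+ρ+s} ∧ |e₂ − e₁| ≤ |ϖ|^{ℓ+ρ} ∧ |(e₂ − e₀)·y·ϖ^{ρ+s} + (e₀ − e₁)·x·z| ≤ |ϖ|^{ℓ+3ρ+s}` (★ p859056 at `(b, c) = (ρ+s, 2ρ)`).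
[cite: Serre1980Trees, Ch. II §1.1] [cite: Kottwitz1986BaseChangeUnits, §1 pp. 240–241] -/
theorem latticeInLevel_diagonal_latt_G3_iff {ϖ : K} (hϖ0 : ϖ ≠ 0) (ℓ ρ s : ℕ) (e : Fin 3 → K) {x z : K} (hx : Valued.v x = 1) (y : K)
    (hz : Valued.v z = Valued.v (ϖ ^ ρ)) :
    LatticeInLevel ϖ ℓ (Matrix.diagonal e) (latt (!![1, 0, 0; x, ϖ ^ (ρ + s), 0; y, z, ϖ ^ (2 * ρ)] : Matrix (Fin 3) (Fin 3) K)) ↔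
      (Valued.v (e 0) ≤ Valued.v ϖ ^ ℓ ∧ Valued.v (e 1) ≤ Valued.v ϖ ^ ℓ ∧ Valued.v (e 2) ≤ Valued.v ϖ ^ ℓ) ∧
        Valued.v (e 1 - e 0) ≤ Valued.v ϖ ^ (ℓ + ρ + s) ∧ Valued.v (e 2 - e 1) ≤ Valued.v ϖ ^ (ℓ + ρ) ∧
          Valued.v ((e 2 - e 0) * y * ϖ ^ (ρ + s) + (e 0 - e 1) * x * z) ≤ Valued.v ϖ ^ (ℓ + 3 * ρ + s) := by
  have hvϖ : 0 < Valued.v ϖ := (Valuation.pos_iff _).2 hϖ0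
  have hform : (!![1, 0, 0; x, ϖ ^ (ρ + s), 0; y, z, ϖ ^ (2 * ρ)] : Matrix (Fin 3) (Fin 3) K) =
      Matrix.of ![![1, 0, 0], ![x, ϖ ^ (ρ + s), 0], ![y, z, ϖ ^ (2 * ρ)]] := rfl
  rw [hform, latticeInLevel_diagonal_latt_hnf_pow_iff hϖ0 ℓ (ρ + s) (2 * ρ) e x y z]
  have e1 : Valued.v ((e 1 - e 0) * x) ≤ Valued.v ϖ ^ (ℓ + (ρ + s)) ↔ Valued.v (e 1 - e 0) ≤ Valued.v ϖ ^ (ℓ + ρ + s) := by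
    rw [map_mul, hx, mul_one, add_assoc]
  have e2 : Valued.v ((e 2 - e 1) * z) ≤ Valued.v ϖ ^ (ℓ + 2 * ρ) ↔ Valued.v (e 2 - e 1) ≤ Valued.v ϖ ^ (ℓ + ρ) := by
    rw [map_mul, hz, map_pow, show Valued.v ϖ ^ (ℓ + 2 * ρ) = Valued.v ϖ ^ (ℓ + ρ) * Valued.v ϖ ^ ρ by rw [← pow_add]; congr 1; ring]
    exact mul_le_mul_iff_left₀ (pow_pos hvϖ _)
  have e3 : Valued.v ϖ ^ (ℓ + (ρ + s) + 2 * ρ) = Valued.v ϖ ^ (ℓ + 3 * ρ + s) := by congr 1; ring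
  rw [e1, e2, e3]
  simp only [and_assoc]

/-- **CONSTANCY OFF THE LOCUS**: if `|e₂ − e₀|·|ϖ|^s ≠ |e₀ − e₁|` (and `|y| = 1`), the mixed inequality splits and the token does not see `x, y, z`:
`diag(e)·M ⊆ ϖ^ℓ·M ↔ (∀ i, |e_i| ≤ |ϖ|^ℓ) ∧ |e₁ − e₀| ≤ |ϖ|^{ℓ+ρ+s} ∧ |e₂ − e₁| ≤ |ϖ|^{ℓ+ρ} ∧ |e₂ − e₀| ≤ |ϖ|^{ℓ+2ρ} ∧ |e₀ − e₁| ≤ |ϖ|^{ℓ+2ρ+s}` (ultrametric equality case).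
[cite: Serre1980Trees, Ch. II §1.1] [cite: Kottwitz1986BaseChangeUnits, §1 pp. 240–241] -/
theorem latticeInLevel_diagonal_latt_G3_iff_of_ne {ϖ : K} (hϖ0 : ϖ ≠ 0) (ℓ ρ s : ℕ) (e : Fin 3 → K) {x y z : K} (hx : Valued.v x = 1) (hy : Valued.v y = 1)
    (hz : Valued.v z = Valued.v (ϖ ^ ρ)) (hne : Valued.v (e 2 - e 0) * Valued.v ϖ ^ s ≠ Valued.v (e 0 - e 1)) :
    LatticeInLevel ϖ ℓ (Matrix.diagonal e) (latt (!![1, 0, 0; x, ϖ ^ (ρ + s), 0; y, z, ϖ ^ (2 * ρ)] : Matrix (Fin 3) (Fin 3) K)) ↔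
      (Valued.v (e 0) ≤ Valued.v ϖ ^ ℓ ∧ Valued.v (e 1) ≤ Valued.v ϖ ^ ℓ ∧ Valued.v (e 2) ≤ Valued.v ϖ ^ ℓ) ∧
        Valued.v (e 1 - e 0) ≤ Valued.v ϖ ^ (ℓ + ρ + s) ∧ Valued.v (e 2 - e 1) ≤ Valued.v ϖ ^ (ℓ + ρ) ∧
          (Valued.v (e 2 - e 0) ≤ Valued.v ϖ ^ (ℓ + 2 * ρ) ∧ Valued.v (e 0 - e 1) ≤ Valued.v ϖ ^ (ℓ + 2 * ρ + s)) := by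
  have hvϖ : 0 < Valued.v ϖ := (Valuation.pos_iff _).2 hϖ0
  have hρs : 0 < Valued.v ϖ ^ (ρ + s) := pow_pos hvϖ _
  have hρ' : 0 < Valued.v ϖ ^ ρ := pow_pos hvϖ _
  have h1 : Valued.v ((e 2 - e 0) * y * ϖ ^ (ρ + s)) = Valued.v (e 2 - e 0) * Valued.v ϖ ^ (ρ + s) := by rw [map_mul, map_mul, hy, mul_one, map_pow]
  have h2 : Valued.v ((e 0 - e 1) * x * z) = Valued.v (e 0 - e 1) * Valued.v ϖ ^ ρ := by rw [map_mul, map_mul, hx, mul_one, hz, map_pow]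
  have hne' : Valued.v ((e 2 - e 0) * y * ϖ ^ (ρ + s)) ≠ Valued.v ((e 0 - e 1) * x * z) := by
    rw [h1, h2, pow_add, ← mul_assoc, mul_comm (Valued.v (e 2 - e 0) * Valued.v ϖ ^ ρ), ← mul_assoc, mul_comm _ (Valued.v (e 2 - e 0))]
    exact fun h => hne (mul_right_cancel₀ hρ'.ne' h)
  rw [latticeInLevel_diagonal_latt_G3_iff hϖ0 ℓ ρ s e hx y hz, Valuation.map_add_of_distinct_val _ hne', max_le_iff, h1, h2,
    show Valued.v ϖ ^ (ℓ + 3 * ρ + s) = Valued.v ϖ ^ (ℓ + 2 * ρ) * Valued.v ϖ ^ (ρ + s) by rw [← pow_add]; congr 1; ring,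
    mul_le_mul_iff_left₀ hρs,
    show Valued.v ϖ ^ (ℓ + 2 * ρ) * Valued.v ϖ ^ (ρ + s) = Valued.v ϖ ^ (ℓ + 2 * ρ + s) * Valued.v ϖ ^ ρ by rw [← pow_add, ← pow_add]; congr 1; ring,
    mul_le_mul_iff_left₀ hρ']

end Read

/-! ## §2  The operators of record: the clean shell of `X = diag(α−1, β−1, 0)` on the stratum, in the one-slot cell `2ρ + m* ≤ n₁` -/

section Shell

variable {K : Type} [Field K] [Valued K ℤᵐ⁰] {σ : K →+* K} {ϖ : K} {d t : ℕ} {α β : K} {N₀ n₁ n₂ n₃ : ℕ}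

/-- **THE CLEAN-SHELL READ ON `G₃ = (2ρ+s, 2ρ+s, 2ρ)` IN THE ONE-SLOT CELL** (token-free; ANY `T`): for every member of the stratum, the three shell tokens of
`X = diag(α−1, β−1, 0)` — `X·M ⊆ ϖ^{ℓ₀}M`, `X·M ⊄ ϖ^{ℓ₀+1}M`, `X²·M ⊆ ϖ^{mc}M` (`ℓ₀ = d % 2`, `mc = mcOfRecord d`) — hold iff `2ρ + s + ℓ₀ = n₃` (off the cancellation locus
`n₃ = n₂ + s`: §1 constant reads + the automatic square token; on the locus the isosceles rule gives `n₁ = n₂` and the cell puts the stratum inside level `ℓ₀ + 1`).  The G₃ twin of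
★ `shell_iff_of_mem_stratum_G1` (read `n₁`, cell `n₂` there). [cite: Kottwitz1986BaseChangeUnits, §1 pp. 240–241] [cite: Rogawski1990, §4.9 Prop. 4.9.1 (a) p. 55] -/
theorem shell_iff_of_mem_stratum_G3 (hD : IsRamifiedQuadraticDatum σ ϖ d t)
    (hE : IsElementDatum σ ϖ N₀ α β n₁ n₂ n₃) (hmc : mcOfRecord d ≤ N₀)
    (T : GL (Fin 3) K) (ρ s : ℕ) (hρ : 1 ≤ ρ) (hs : 1 ≤ s) (hcell : 2 * ρ + mstarOfRecord d ≤ n₁) :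
    ∀ M ∈ stratum σ ϖ T ![2 * ρ + s, 2 * ρ + s, 2 * ρ],
      (LatticeInLevel ϖ (d % 2) (Matrix.diagonal ![α - 1, β - 1, 0]) M ∧ ¬ LatticeInLevel ϖ (d % 2 + 1) (Matrix.diagonal ![α - 1, β - 1, 0]) M ∧
          LatticeInLevel ϖ (mcOfRecord d) (Matrix.diagonal ![(α - 1) * (α - 1), (β - 1) * (β - 1), 0]) M) ↔ 2 * ρ + s + d % 2 = n₃ := by
  classical
  have hD' := hD
  obtain ⟨hσ, hvσ, hϖ, hfix, -, hd1, -⟩ := hD'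
  have hϖ0 : ϖ ≠ 0 := fun h0 => by rw [h0, map_zero] at hϖ; exact WithZero.coe_ne_zero hϖ.symm
  have hα : Valued.v (α - 1) = Valued.v ϖ ^ n₂ := hE.2.2.2.2.2.2.1
  have hβ : Valued.v (β - 1) = Valued.v ϖ ^ n₁ := hE.2.2.2.2.2.1
  have hγ : Valued.v (α - β) = Valued.v ϖ ^ n₃ := hE.2.2.2.2.2.2.2.1
  have hn₁ : N₀ ≤ n₁ := hE.2.2.2.2.2.2.2.2.1
  have hn₂ : N₀ ≤ n₂ := hE.2.2.2.2.2.2.2.2.2.1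
  have hn₃ : N₀ ≤ n₃ := hE.2.2.2.2.2.2.2.2.2.2
  have hmcv : mcOfRecord d = 2 * ((d % 2 + 2 * d - 1 + d) / 2) := rfl
  have hmsv : mstarOfRecord d = d % 2 + 2 * d - 1 := rfl
  rw [hmsv] at hcell
  rw [hmcv] at hmc ⊢
  have hq : ∀ n : ℕ, Valued.v ϖ ^ n = WithZero.exp (-(n : ℤ)) := fun n => by
    rw [hϖ, ← WithZero.exp_nsmul]; congr 1; simp
  have hpw : ∀ a b : ℕ, Valued.v ϖ ^ a ≤ Valued.v ϖ ^ b ↔ b ≤ a := fun a b => by rw [hq, hq, WithZero.exp_le_exp]; omega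
  have hpwlt : ∀ a b : ℕ, Valued.v ϖ ^ a < Valued.v ϖ ^ b ↔ b < a := fun a b => by rw [hq, hq, WithZero.exp_lt_exp]; omega
  have hpweq : ∀ a b : ℕ, Valued.v ϖ ^ a = Valued.v ϖ ^ b ↔ a = b := fun a b => by rw [hq, hq, WithZero.exp_inj]; omega
  have hv0 : ∀ k : ℕ, Valued.v (0 : K) ≤ Valued.v ϖ ^ k := fun k => by rw [map_zero]; exact zero_le
  -- the operator entries and their differences
  have hγ' : Valued.v (β - 1 - (α - 1)) = Valued.v ϖ ^ n₃ := by rw [show β - 1 - (α - 1) = -(α - β) by ring, Valuation.map_neg, hγ]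
  have hγ'' : Valued.v (α - 1 - (β - 1)) = Valued.v ϖ ^ n₃ := by rw [show α - 1 - (β - 1) = α - β by ring, hγ]
  have hA2 : Valued.v ((α - 1) * (α - 1)) = Valued.v ϖ ^ (2 * n₂) := by rw [map_mul, hα, ← pow_add, two_mul]
  have hB2 : Valued.v ((β - 1) * (β - 1)) = Valued.v ϖ ^ (2 * n₁) := by rw [map_mul, hβ, ← pow_add, two_mul]
  -- the isosceles rule of the root depths
  have hiso : min n₁ n₂ ≤ n₃ := by
    have h := Valuation.map_sub Valued.v (β - 1) (α - 1)
    rw [hγ', hβ, hα, le_max_iff, hpw, hpw] at h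
    omega
  have hiso₂ : n₂ < n₁ → n₃ = n₂ := fun h => by
    have hlt : Valued.v (β - 1) < Valued.v (α - 1) := by rw [hα, hβ, hpwlt]; exact h
    have e := Valuation.map_sub_eq_of_lt_left _ hlt
    rw [hγ'', hα, hpweq] at e
    exact e
  have hiso₁ : n₁ < n₂ → n₃ = n₁ := fun h => by
    have hlt : Valued.v (α - 1) < Valued.v (β - 1) := by rw [hα, hβ, hpwlt]; exact h
    have e := Valuation.map_sub_eq_of_lt_left _ hlt
    rw [hγ', hβ, hpweq] at e
    exact e
  -- the difference of squares `(α−1)² − (β−1)² = (α−β)·((α−1)+(β−1))`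
  have hsqdiff : Valued.v ((α - 1) * (α - 1) - (β - 1) * (β - 1)) ≤ Valued.v ϖ ^ (n₃ + min n₁ n₂) := by
    rw [show (α - 1) * (α - 1) - (β - 1) * (β - 1) = (α - β) * ((α - 1) + (β - 1)) by ring, map_mul, hγ, pow_add]
    refine mul_le_mul' le_rfl ((Valuation.map_add _ _ _).trans (max_le ?_ ?_))
    · rw [hα, hpw]; exact min_le_right _ _
    · rw [hβ, hpw]; exact min_le_left _ _
  intro M hM
  rw [stratum_G3_eq hvσ hfix hϖ T hρ hs] at hM
  obtain ⟨x, y, z, hx, hy, hz, rfl, -, -⟩ := hM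
  -- THE SQUARE TOKEN holds as soon as `n₃ + min n₁ n₂ ≥ mc + 2ρ + s`, `2 n₂ ≥ mc + 2ρ`, `2 n₁ ≥ mc + ρ`
  have hsq : 2 * ρ + s + d % 2 = n₃ → 2 * ρ ≤ n₂ →
      LatticeInLevel ϖ (2 * ((d % 2 + 2 * d - 1 + d) / 2)) (Matrix.diagonal ![(α - 1) * (α - 1), (β - 1) * (β - 1), 0])
        (latt (!![1, 0, 0; x, ϖ ^ (ρ + s), 0; y, z, ϖ ^ (2 * ρ)] : Matrix (Fin 3) (Fin 3) K)) := fun hP h2 => by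
    rw [latticeInLevel_diagonal_latt_G3_iff hϖ0 _ ρ s _ hx y hz]
    simp only [Matrix.cons_val_zero, Matrix.cons_val_one, Matrix.cons_val_two, Matrix.tail_cons, Matrix.head_cons, zero_sub, Valuation.map_neg]
    refine ⟨⟨?_, ?_, hv0 _⟩, ?_, ?_, ?_⟩
    · rw [hA2, hpw]; omega
    · rw [hB2, hpw]; omega
    · rw [show (β - 1) * (β - 1) - (α - 1) * (α - 1) = -((α - 1) * (α - 1) - (β - 1) * (β - 1)) by ring, Valuation.map_neg]
      refine hsqdiff.trans ?_
      rw [hpw]; omega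
    · rw [hB2, hpw]; omega
    · refine (Valuation.map_add _ _ _).trans (max_le ?_ ?_)
      · rw [map_mul, map_mul, Valuation.map_neg, hA2, hy, mul_one, map_pow, ← pow_add, hpw]; omega
      · rw [map_mul, map_mul, hx, mul_one, hz, map_pow]
        refine (mul_le_mul' hsqdiff le_rfl).trans ?_
        rw [← pow_add, hpw]; omega
  by_cases hloc : n₃ = n₂ + s
  · -- ON THE CANCELLATION LOCUS: `n₁ = n₂` (isosceles), the cell puts the stratum inside level `ℓ₀ + 1`, and the read is false
    have h12 : n₁ = n₂ := by
      rcases lt_trichotomy n₁ n₂ with h | h | h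
      · have := hiso₁ h; omega
      · exact h
      · have := hiso₂ h; omega
    have htok : LatticeInLevel ϖ (d % 2 + 1) (Matrix.diagonal ![α - 1, β - 1, 0])
        (latt (!![1, 0, 0; x, ϖ ^ (ρ + s), 0; y, z, ϖ ^ (2 * ρ)] : Matrix (Fin 3) (Fin 3) K)) := by
      rw [latticeInLevel_diagonal_latt_G3_iff hϖ0 _ ρ s _ hx y hz]
      simp only [Matrix.cons_val_zero, Matrix.cons_val_one, Matrix.cons_val_two, Matrix.tail_cons, Matrix.head_cons, zero_sub, Valuation.map_neg]
      refine ⟨⟨?_, ?_, hv0 _⟩, ?_, ?_, ?_⟩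
      · rw [hα, hpw]; omega
      · rw [hβ, hpw]; omega
      · rw [hγ', hpw]; omega
      · rw [hβ, hpw]; omega
      · refine (Valuation.map_add _ _ _).trans (max_le ?_ ?_)
        · rw [map_mul, map_mul, Valuation.map_neg, hα, hy, mul_one, map_pow, ← pow_add, hpw]; omega
        · rw [map_mul, map_mul, hγ'', hx, mul_one, hz, map_pow, ← pow_add, hpw]; omega
    constructor
    · rintro ⟨-, h, -⟩; exact absurd htok h
    · intro h; omega
  · -- OFF THE LOCUS: the level tokens are constant reads; the cell and the isosceles rule leave only the `n₃`-equality
    have hne : Valued.v ((![α - 1, β - 1, 0] : Fin 3 → K) 2 - (![α - 1, β - 1, 0] : Fin 3 → K) 0) * Valued.v ϖ ^ s ≠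
        Valued.v ((![α - 1, β - 1, 0] : Fin 3 → K) 0 - (![α - 1, β - 1, 0] : Fin 3 → K) 1) := by
      simp only [Matrix.cons_val_zero, Matrix.cons_val_one, Matrix.cons_val_two, Matrix.tail_cons, Matrix.head_cons, zero_sub, Valuation.map_neg, hα, hγ'', ← pow_add]
      rw [Ne, hpweq]; omega
    have htok : ∀ ℓ : ℕ, LatticeInLevel ϖ ℓ (Matrix.diagonal ![α - 1, β - 1, 0])
        (latt (!![1, 0, 0; x, ϖ ^ (ρ + s), 0; y, z, ϖ ^ (2 * ρ)] : Matrix (Fin 3) (Fin 3) K)) ↔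
          (ℓ ≤ n₂ ∧ ℓ ≤ n₁) ∧ ℓ + ρ + s ≤ n₃ ∧ ℓ + ρ ≤ n₁ ∧ (ℓ + 2 * ρ ≤ n₂ ∧ ℓ + 2 * ρ + s ≤ n₃) := fun ℓ => by
      rw [latticeInLevel_diagonal_latt_G3_iff_of_ne hϖ0 ℓ ρ s _ hx hy hz hne]
      simp only [Matrix.cons_val_zero, Matrix.cons_val_one, Matrix.cons_val_two, Matrix.tail_cons, Matrix.head_cons, zero_sub, Valuation.map_neg, hv0, and_true,
        hα, hβ, hγ', hγ'', hpw]
    rw [htok, htok]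
    constructor
    · rintro ⟨⟨-, h3, -, h2, h3'⟩, hnot, -⟩
      have hn₂' : d % 2 + 1 + 2 * ρ ≤ n₂ := by
        by_contra hc
        have h2e : n₂ = d % 2 + 2 * ρ := by omega
        have := hiso₂ (by omega)
        omega
      by_contra hR
      exact hnot ⟨⟨by omega, by omega⟩, by omega, by omega, by omega, by omega⟩
    · intro hP
      have hn₂' : d % 2 + 2 * ρ ≤ n₂ := by
        rcases lt_or_ge n₂ n₁ with h | h
        · have := hiso₂ h; omega
        · omega
      exact ⟨⟨⟨by omega, by omega⟩, by omega, by omega, by omega, by omega⟩, fun h => by omega, hsq hP (by omega)⟩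

/-- **THE TUBE INEQUALITIES ON THE READ** (token-free; ANY `T`, no membership needed beyond the letters): in the one-slot cell `2ρ + m* ≤ n₁`, the read `2ρ + s + ℓ₀ = n₃` gives
`2ρ + s ≤ n₃`, `2ρ ≤ n₁` (the cell) and `2ρ ≤ n₂` (isosceles: `n₂ < n₁ ⇒ n₃ = n₂`) — so the indicator `2ρ ≤ min n₁ n₂` of the predicted G₃ column is automatic in the cell.
[cite: Kottwitz1986BaseChangeUnits, §1 pp. 240–241] [cite: Rogawski1990, §4.9 Prop. 4.9.1 (a) p. 55] -/
theorem tube_of_read_G3 (hD : IsRamifiedQuadraticDatum σ ϖ d t) (hE : IsElementDatum σ ϖ N₀ α β n₁ n₂ n₃)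
    (ρ s : ℕ) (hcell : 2 * ρ + mstarOfRecord d ≤ n₁) (hP : 2 * ρ + s + d % 2 = n₃) :
    2 * ρ + s ≤ n₃ ∧ 2 * ρ ≤ n₁ ∧ 2 * ρ ≤ n₂ := by
  have hD' := hD
  obtain ⟨-, -, hϖ, -, -, -, -⟩ := hD'
  have hα : Valued.v (α - 1) = Valued.v ϖ ^ n₂ := hE.2.2.2.2.2.2.1
  have hβ : Valued.v (β - 1) = Valued.v ϖ ^ n₁ := hE.2.2.2.2.2.1
  have hγ : Valued.v (α - β) = Valued.v ϖ ^ n₃ := hE.2.2.2.2.2.2.2.1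
  have hmsv : mstarOfRecord d = d % 2 + 2 * d - 1 := rfl
  rw [hmsv] at hcell
  have hq : ∀ n : ℕ, Valued.v ϖ ^ n = WithZero.exp (-(n : ℤ)) := fun n => by
    rw [hϖ, ← WithZero.exp_nsmul]; congr 1; simp
  have hpwlt : ∀ a b : ℕ, Valued.v ϖ ^ a < Valued.v ϖ ^ b ↔ b < a := fun a b => by rw [hq, hq, WithZero.exp_lt_exp]; omega
  have hpweq : ∀ a b : ℕ, Valued.v ϖ ^ a = Valued.v ϖ ^ b ↔ a = b := fun a b => by rw [hq, hq, WithZero.exp_inj]; omega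
  have hiso₂ : n₂ < n₁ → n₃ = n₂ := fun h => by
    have hlt : Valued.v (β - 1) < Valued.v (α - 1) := by rw [hα, hβ, hpwlt]; exact h
    have e := Valuation.map_sub_eq_of_lt_left _ hlt
    rw [show α - 1 - (β - 1) = α - β by ring, hγ, hα, hpweq] at e
    exact e
  refine ⟨by omega, by omega, ?_⟩
  rcases lt_or_ge n₂ n₁ with h | h
  · have := hiso₂ h; omega
  · omega

/-- **THE `htube` BINDER OF THE (P2b) SUM FILE, ON THE NOSE** (★ p861290 `finsum_stratum_G3_shell_labelledOdd_div_relIndex_eq` ∕ `…_eq_zero_of_not`, LH4-p10 (g6)):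
for every member of the stratum `(2ρ+s, 2ρ+s, 2ρ)` in the cell, the read `2ρ + s + ℓ₀ = n₃` gives `2 ∣ s` (★ `two_dvd_of_mem_stratum_G3`) and `2ρ ≤ n₁`, `2ρ ≤ n₂`
(`tube_of_read_G3`). [cite: Kottwitz1986BaseChangeUnits, §1 pp. 240–241] [cite: Rogawski1990, §4.9 Prop. 4.9.1 (a) p. 55] -/
theorem tube_of_mem_stratum_G3 (hD : IsRamifiedQuadraticDatum σ ϖ d t) (hE : IsElementDatum σ ϖ N₀ α β n₁ n₂ n₃)
    (T : GL (Fin 3) K) (ρ s : ℕ) (hρ : 1 ≤ ρ) (hs : 1 ≤ s) (hcell : 2 * ρ + mstarOfRecord d ≤ n₁) :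
    ∀ M ∈ stratum σ ϖ T ![2 * ρ + s, 2 * ρ + s, 2 * ρ], 2 * ρ + s + d % 2 = n₃ → 2 ∣ s ∧ 2 * ρ ≤ n₁ ∧ 2 * ρ ≤ n₂ := by
  intro M hM hP
  have hD' := hD
  obtain ⟨-, hvσ, hϖ, hfix, -, -, -⟩ := hD'
  obtain ⟨-, h1, h2⟩ := tube_of_read_G3 hD hE ρ s hcell hP
  exact ⟨two_dvd_of_mem_stratum_G3 hvσ hfix hϖ T hρ hs hM, h1, h2⟩

/-- **THE CLEAN-SHELL READ UNDER THE TUBE GUARD (ED. 2; the ε-BOUNDARY towers' letter)**: for every member of the stratum `(2ρ+s, 2ρ+s, 2ρ)`, under the tube guard `2ρ + 2 + ℓ₀ ≤ min n₁ n₂`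
of ★ (T1) p861261's capped tube classes `hG3t` (in force inside AND beyond the one-slot cell) the three shell tokens of `X = diag(α−1, β−1, 0)` hold iff `2ρ + s + ℓ₀ = n₃`; NO cell hypothesis,
ANY `T` (same proof as the cell version, the guard deciding every letter).  Consumer: the R5 «G₃ ε-boundary tower». [cite: Kottwitz1986BaseChangeUnits, §1 pp. 240–241] [cite: Rogawski1990, §4.9 Prop. 4.9.1 (a) p. 55] -/
theorem shell_iff_of_mem_stratum_G3_of_guard (hD : IsRamifiedQuadraticDatum σ ϖ d t)
    (hE : IsElementDatum σ ϖ N₀ α β n₁ n₂ n₃) (hmc : mcOfRecord d ≤ N₀)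
    (T : GL (Fin 3) K) (ρ s : ℕ) (hρ : 1 ≤ ρ) (hs : 1 ≤ s) (hguard : 2 * ρ + 2 + d % 2 ≤ min n₁ n₂) :
    ∀ M ∈ stratum σ ϖ T ![2 * ρ + s, 2 * ρ + s, 2 * ρ],
      (LatticeInLevel ϖ (d % 2) (Matrix.diagonal ![α - 1, β - 1, 0]) M ∧ ¬ LatticeInLevel ϖ (d % 2 + 1) (Matrix.diagonal ![α - 1, β - 1, 0]) M ∧
          LatticeInLevel ϖ (mcOfRecord d) (Matrix.diagonal ![(α - 1) * (α - 1), (β - 1) * (β - 1), 0]) M) ↔ 2 * ρ + s + d % 2 = n₃ := by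
  classical
  have hD' := hD
  obtain ⟨hσ, hvσ, hϖ, hfix, -, hd1, -⟩ := hD'
  have hϖ0 : ϖ ≠ 0 := fun h0 => by rw [h0, map_zero] at hϖ; exact WithZero.coe_ne_zero hϖ.symm
  have hα : Valued.v (α - 1) = Valued.v ϖ ^ n₂ := hE.2.2.2.2.2.2.1
  have hβ : Valued.v (β - 1) = Valued.v ϖ ^ n₁ := hE.2.2.2.2.2.1
  have hγ : Valued.v (α - β) = Valued.v ϖ ^ n₃ := hE.2.2.2.2.2.2.2.1
  have hn₁ : N₀ ≤ n₁ := hE.2.2.2.2.2.2.2.2.1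
  have hn₂ : N₀ ≤ n₂ := hE.2.2.2.2.2.2.2.2.2.1
  have hn₃ : N₀ ≤ n₃ := hE.2.2.2.2.2.2.2.2.2.2
  have hmcv : mcOfRecord d = 2 * ((d % 2 + 2 * d - 1 + d) / 2) := rfl
  rw [hmcv] at hmc ⊢
  have hg₁ : 2 * ρ + 2 + d % 2 ≤ n₁ := (le_min_iff.1 hguard).1
  have hg₂ : 2 * ρ + 2 + d % 2 ≤ n₂ := (le_min_iff.1 hguard).2
  have hq : ∀ n : ℕ, Valued.v ϖ ^ n = WithZero.exp (-(n : ℤ)) := fun n => by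
    rw [hϖ, ← WithZero.exp_nsmul]; congr 1; simp
  have hpw : ∀ a b : ℕ, Valued.v ϖ ^ a ≤ Valued.v ϖ ^ b ↔ b ≤ a := fun a b => by rw [hq, hq, WithZero.exp_le_exp]; omega
  have hpwlt : ∀ a b : ℕ, Valued.v ϖ ^ a < Valued.v ϖ ^ b ↔ b < a := fun a b => by rw [hq, hq, WithZero.exp_lt_exp]; omega
  have hpweq : ∀ a b : ℕ, Valued.v ϖ ^ a = Valued.v ϖ ^ b ↔ a = b := fun a b => by rw [hq, hq, WithZero.exp_inj]; omega
  have hv0 : ∀ k : ℕ, Valued.v (0 : K) ≤ Valued.v ϖ ^ k := fun k => by rw [map_zero]; exact zero_le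
  have hγ' : Valued.v (β - 1 - (α - 1)) = Valued.v ϖ ^ n₃ := by rw [show β - 1 - (α - 1) = -(α - β) by ring, Valuation.map_neg, hγ]
  have hγ'' : Valued.v (α - 1 - (β - 1)) = Valued.v ϖ ^ n₃ := by rw [show α - 1 - (β - 1) = α - β by ring, hγ]
  have hA2 : Valued.v ((α - 1) * (α - 1)) = Valued.v ϖ ^ (2 * n₂) := by rw [map_mul, hα, ← pow_add, two_mul]
  have hB2 : Valued.v ((β - 1) * (β - 1)) = Valued.v ϖ ^ (2 * n₁) := by rw [map_mul, hβ, ← pow_add, two_mul]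
  have hiso₂ : n₂ < n₁ → n₃ = n₂ := fun h => by
    have hlt : Valued.v (β - 1) < Valued.v (α - 1) := by rw [hα, hβ, hpwlt]; exact h
    have e := Valuation.map_sub_eq_of_lt_left _ hlt
    rw [hγ'', hα, hpweq] at e
    exact e
  have hiso₁ : n₁ < n₂ → n₃ = n₁ := fun h => by
    have hlt : Valued.v (α - 1) < Valued.v (β - 1) := by rw [hα, hβ, hpwlt]; exact h
    have e := Valuation.map_sub_eq_of_lt_left _ hlt
    rw [hγ', hβ, hpweq] at e
    exact e
  have hsqdiff : Valued.v ((α - 1) * (α - 1) - (β - 1) * (β - 1)) ≤ Valued.v ϖ ^ (n₃ + min n₁ n₂) := by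
    rw [show (α - 1) * (α - 1) - (β - 1) * (β - 1) = (α - β) * ((α - 1) + (β - 1)) by ring, map_mul, hγ, pow_add]
    refine mul_le_mul' le_rfl ((Valuation.map_add _ _ _).trans (max_le ?_ ?_))
    · rw [hα, hpw]; exact min_le_right _ _
    · rw [hβ, hpw]; exact min_le_left _ _
  intro M hM
  rw [stratum_G3_eq hvσ hfix hϖ T hρ hs] at hM
  obtain ⟨x, y, z, hx, hy, hz, rfl, -, -⟩ := hM
  have hsq : 2 * ρ + s + d % 2 = n₃ →
      LatticeInLevel ϖ (2 * ((d % 2 + 2 * d - 1 + d) / 2)) (Matrix.diagonal ![(α - 1) * (α - 1), (β - 1) * (β - 1), 0])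
        (latt (!![1, 0, 0; x, ϖ ^ (ρ + s), 0; y, z, ϖ ^ (2 * ρ)] : Matrix (Fin 3) (Fin 3) K)) := fun hP => by
    rw [latticeInLevel_diagonal_latt_G3_iff hϖ0 _ ρ s _ hx y hz]
    simp only [Matrix.cons_val_zero, Matrix.cons_val_one, Matrix.cons_val_two, Matrix.tail_cons, Matrix.head_cons, zero_sub, Valuation.map_neg]
    refine ⟨⟨?_, ?_, hv0 _⟩, ?_, ?_, ?_⟩
    · rw [hA2, hpw]; omega
    · rw [hB2, hpw]; omega
    · rw [show (β - 1) * (β - 1) - (α - 1) * (α - 1) = -((α - 1) * (α - 1) - (β - 1) * (β - 1)) by ring, Valuation.map_neg]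
      refine hsqdiff.trans ?_
      rw [hpw]; omega
    · rw [hB2, hpw]; omega
    · refine (Valuation.map_add _ _ _).trans (max_le ?_ ?_)
      · rw [map_mul, map_mul, Valuation.map_neg, hA2, hy, mul_one, map_pow, ← pow_add, hpw]; omega
      · rw [map_mul, map_mul, hx, mul_one, hz, map_pow]
        refine (mul_le_mul' hsqdiff le_rfl).trans ?_
        rw [← pow_add, hpw]; omega
  by_cases hloc : n₃ = n₂ + s
  · have htok : LatticeInLevel ϖ (d % 2 + 1) (Matrix.diagonal ![α - 1, β - 1, 0])
        (latt (!![1, 0, 0; x, ϖ ^ (ρ + s), 0; y, z, ϖ ^ (2 * ρ)] : Matrix (Fin 3) (Fin 3) K)) := by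
      rw [latticeInLevel_diagonal_latt_G3_iff hϖ0 _ ρ s _ hx y hz]
      simp only [Matrix.cons_val_zero, Matrix.cons_val_one, Matrix.cons_val_two, Matrix.tail_cons, Matrix.head_cons, zero_sub, Valuation.map_neg]
      refine ⟨⟨?_, ?_, hv0 _⟩, ?_, ?_, ?_⟩
      · rw [hα, hpw]; omega
      · rw [hβ, hpw]; omega
      · rw [hγ', hpw]; omega
      · rw [hβ, hpw]; omega
      · refine (Valuation.map_add _ _ _).trans (max_le ?_ ?_)
        · rw [map_mul, map_mul, Valuation.map_neg, hα, hy, mul_one, map_pow, ← pow_add, hpw]; omega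
        · rw [map_mul, map_mul, hγ'', hx, mul_one, hz, map_pow, ← pow_add, hpw]; omega
    constructor
    · rintro ⟨-, h, -⟩; exact absurd htok h
    · intro h; omega
  · have hne : Valued.v ((![α - 1, β - 1, 0] : Fin 3 → K) 2 - (![α - 1, β - 1, 0] : Fin 3 → K) 0) * Valued.v ϖ ^ s ≠
        Valued.v ((![α - 1, β - 1, 0] : Fin 3 → K) 0 - (![α - 1, β - 1, 0] : Fin 3 → K) 1) := by
      simp only [Matrix.cons_val_zero, Matrix.cons_val_one, Matrix.cons_val_two, Matrix.tail_cons, Matrix.head_cons, zero_sub, Valuation.map_neg, hα, hγ'', ← pow_add]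
      rw [Ne, hpweq]; omega
    have htok : ∀ ℓ : ℕ, LatticeInLevel ϖ ℓ (Matrix.diagonal ![α - 1, β - 1, 0])
        (latt (!![1, 0, 0; x, ϖ ^ (ρ + s), 0; y, z, ϖ ^ (2 * ρ)] : Matrix (Fin 3) (Fin 3) K)) ↔
          (ℓ ≤ n₂ ∧ ℓ ≤ n₁) ∧ ℓ + ρ + s ≤ n₃ ∧ ℓ + ρ ≤ n₁ ∧ (ℓ + 2 * ρ ≤ n₂ ∧ ℓ + 2 * ρ + s ≤ n₃) := fun ℓ => by
      rw [latticeInLevel_diagonal_latt_G3_iff_of_ne hϖ0 ℓ ρ s _ hx hy hz hne]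
      simp only [Matrix.cons_val_zero, Matrix.cons_val_one, Matrix.cons_val_two, Matrix.tail_cons, Matrix.head_cons, zero_sub, Valuation.map_neg, hv0, and_true,
        hα, hβ, hγ', hγ'', hpw]
    rw [htok, htok]
    constructor
    · rintro ⟨⟨-, h3, -, h2, h3'⟩, hnot, -⟩
      by_contra hR
      exact hnot ⟨⟨by omega, by omega⟩, by omega, by omega, by omega, by omega⟩
    · intro hP
      exact ⟨⟨⟨by omega, by omega⟩, by omega, by omega, by omega, by omega⟩, fun h => by omega, hsq hP⟩

/-- **CONVENIENCE FORM**: under the tube guard, on the read `2ρ + s + ℓ₀ = n₃` EVERY member of `(2ρ+s, 2ρ+s, 2ρ)` is on the clean shell. [cite: Kottwitz1986BaseChangeUnits, §1 pp. 240–241] -/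
theorem shell_of_mem_stratum_G3_of_guard (hD : IsRamifiedQuadraticDatum σ ϖ d t)
    (hE : IsElementDatum σ ϖ N₀ α β n₁ n₂ n₃) (hmc : mcOfRecord d ≤ N₀)
    (T : GL (Fin 3) K) (ρ s : ℕ) (hρ : 1 ≤ ρ) (hs : 1 ≤ s) (hguard : 2 * ρ + 2 + d % 2 ≤ min n₁ n₂) (hP : 2 * ρ + s + d % 2 = n₃)
    {M : Submodule 𝒪[K] (Fin 3 → K)} (hM : M ∈ stratum σ ϖ T ![2 * ρ + s, 2 * ρ + s, 2 * ρ]) :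
    LatticeInLevel ϖ (d % 2) (Matrix.diagonal ![α - 1, β - 1, 0]) M ∧ ¬ LatticeInLevel ϖ (d % 2 + 1) (Matrix.diagonal ![α - 1, β - 1, 0]) M ∧
      LatticeInLevel ϖ (mcOfRecord d) (Matrix.diagonal ![(α - 1) * (α - 1), (β - 1) * (β - 1), 0]) M :=
  (shell_iff_of_mem_stratum_G3_of_guard hD hE hmc T ρ s hρ hs hguard M hM).2 hP

end Shell

end Summit.HodgeConjecture.HodgeConjecture.Cruxes.H413.F0P3cDyRamLabelledOddPureStrataG3Shell

end
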